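import Mathlib.Algebra.Order.Interval.Finset.SuccPred
import Literature.MathematicalPhysics.KineticTheory.InfiniteChainDynamics
import HarnessLib

/-!
# Window densities of the transfer-operator Markov chain: the product algebra

Topic `Literature/MathematicalPhysics/KineticTheory`; theorems only (no definitions, no named
facts). For the oscillator chain `P : OscillatorChain`, a temperature `T`, and transfer eigen-data
`(λ, ψ)` (see `InfiniteChainTransferOperator.lean`, `InfiniteChainMarkovKernel.lean`), the law of
the stationary two-sided Markov chain of Cassandro–Olivieri–Pellegrinotti–Presutti (1978), §2 on
the window `{a, …, b} ⊆ ℤ` (`a ≤ b`) has the density, with respect to `(dq dp)^{⊗ {a,…,b}}`,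
```
ρ_{a,b}(σ) = ψ(q_a) ψ(q_b) λ^{-(b-a)} ∏_{x=a}^{b} [e^{-U(q_x)/T} (2πT)^{-1/2} e^{-p_x²/(2T)}]
             ∏_{x=a}^{b-1} e^{-V(q_{x+1}-q_x)/T}
```
(written inline below; `σ x = (q_x, p_x)`). This file records the pure product algebra of these
densities (no integration):

* `windowDensity_succ_right` — **adding a site on the right multiplies by the transition weight**:
  `ρ_{a,b+1}(σ) = ρ_{a,b}(σ) · [λ⁻¹ ψ(q_b)⁻¹ e^{-U(q_{b+1})/T} e^{-V(q_{b+1}-q_b)/T} ψ(q_{b+1})]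
  · [(2πT)^{-1/2} e^{-p_{b+1}²/(2T)}]` (`ψ(q_b) ≠ 0`), the factor being exactly the transition
  weight `τ(q_b; q_{b+1}, p_{b+1})` of `InfiniteChainMarkovKernel.lean` — so that the one-site peel
  `lmarginal_singleton_mul_transitionWeight` gives the consistency
  `∫ ρ_{a,b+1} d(q_{b+1}, p_{b+1}) = ρ_{a,b}`;
* `windowDensity_pred_left` — the same on the left (factor `τ(q_a; q_{a-1}, p_{a-1})` once `V` is even);
* `windowDensity_self` — the one-site density `ρ_{a,a}(σ) = ψ(q_a)² e^{-U(q_a)/T} (2πT)^{-1/2} e^{-p_a²/(2T)}`.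

## References

* M. Cassandro, E. Olivieri, A. Pellegrinotti, E. Presutti, Z. Wahrsch. verw. Gebiete 41 (1978)
  313–334, §2.
* H.-O. Georgii, *Gibbs Measures and Phase Transitions* (2011), §3.1 (finite-dimensional laws of a
  Markov chain with positive transition densities). [Georgii2011]
-/

noncomputable section

open Finset

namespace Literature.MathematicalPhysics.KineticTheory.HeatConduction

namespace OscillatorChain

variable (P : OscillatorChain)

/-- **Adding a site on the right multiplies the window density by the transition weight**:
for `a ≤ b` and `ψ(q_b) ≠ 0`,
`ρ_{a,b+1}(σ) = ρ_{a,b}(σ) · λ⁻¹ ψ(q_b)⁻¹ e^{-U(q_{b+1})/T} e^{-V(q_{b+1}-q_b)/T} ψ(q_{b+1})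
· (2πT)^{-1/2} e^{-p_{b+1}²/(2T)}` (Georgii 2011, §3.1, (3.3): the finite-dimensional laws of a
Markov chain are the initial density times the product of transition densities).
[cite: Georgii2011, §3.1] -/
theorem windowDensity_succ_right (T lam : ℝ) (ψ : ℝ → ℝ) {a b : ℤ} (hab : a ≤ b)
    (σ : ChainConfig) (hψb : ψ (σ b).1 ≠ 0) :
    ψ (σ a).1 * ψ (σ (b + 1)).1 * lam⁻¹ ^ (b + 1 - a).toNat *
        (∏ x ∈ Icc a (b + 1), (Real.exp (-T⁻¹ * P.U (σ x).1) *
          ((Real.sqrt (2 * Real.pi * T))⁻¹ * Real.exp (-(σ x).2 ^ 2 / (2 * T))))) *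
        ∏ x ∈ Ico a (b + 1), Real.exp (-T⁻¹ * P.V ((σ (x + 1)).1 - (σ x).1)) =
      (ψ (σ a).1 * ψ (σ b).1 * lam⁻¹ ^ (b - a).toNat *
        (∏ x ∈ Icc a b, (Real.exp (-T⁻¹ * P.U (σ x).1) *
          ((Real.sqrt (2 * Real.pi * T))⁻¹ * Real.exp (-(σ x).2 ^ 2 / (2 * T))))) *
        ∏ x ∈ Ico a b, Real.exp (-T⁻¹ * P.V ((σ (x + 1)).1 - (σ x).1))) *
      ((lam⁻¹ * (ψ (σ b).1)⁻¹ *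
          (Real.exp (-T⁻¹ * P.U (σ (b + 1)).1) *
            (Real.exp (-T⁻¹ * P.V ((σ (b + 1)).1 - (σ b).1)) * ψ (σ (b + 1)).1))) *
        ((Real.sqrt (2 * Real.pi * T))⁻¹ * Real.exp (-(σ (b + 1)).2 ^ 2 / (2 * T)))) := by
  -- split off the new site from both products
  have hIcc : Icc a (b + 1) = insert (b + 1) (Icc a b) :=
    (insert_Icc_right_eq_Icc_add_one (by omega)).symm
  have hIco : Ico a (b + 1) = insert b (Ico a b) :=
    (insert_Ico_right_eq_Ico_add_one_of_not_isMax hab (not_isMax b)).symm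
  have hnot1 : b + 1 ∉ Icc a b := by simp
  have hnot2 : b ∉ Ico a b := by simp
  have hpow : (b + 1 - a).toNat = (b - a).toNat + 1 := by omega
  rw [hIcc, hIco, prod_insert hnot1, prod_insert hnot2, hpow, pow_succ]
  field_simp

/-- **Adding a site on the left multiplies the window density by the (reversed) transition weight**:
for `a ≤ b` and `ψ(q_a) ≠ 0`,
`ρ_{a-1,b}(σ) = ρ_{a,b}(σ) · λ⁻¹ ψ(q_a)⁻¹ e^{-U(q_{a-1})/T} e^{-V(q_a-q_{a-1})/T} ψ(q_{a-1})
· (2πT)^{-1/2} e^{-p_{a-1}²/(2T)}`; for even `V` the factor is the transition weight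
`τ(q_a; q_{a-1}, p_{a-1})` (reversibility of the stationary chain) (Georgii 2011, §3.1).
[cite: Georgii2011, §3.1] -/
theorem windowDensity_pred_left (T lam : ℝ) (ψ : ℝ → ℝ) {a b : ℤ} (hab : a ≤ b)
    (σ : ChainConfig) (hψa : ψ (σ a).1 ≠ 0) :
    ψ (σ (a - 1)).1 * ψ (σ b).1 * lam⁻¹ ^ (b - (a - 1)).toNat *
        (∏ x ∈ Icc (a - 1) b, (Real.exp (-T⁻¹ * P.U (σ x).1) *
          ((Real.sqrt (2 * Real.pi * T))⁻¹ * Real.exp (-(σ x).2 ^ 2 / (2 * T))))) *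
        ∏ x ∈ Ico (a - 1) b, Real.exp (-T⁻¹ * P.V ((σ (x + 1)).1 - (σ x).1)) =
      (ψ (σ a).1 * ψ (σ b).1 * lam⁻¹ ^ (b - a).toNat *
        (∏ x ∈ Icc a b, (Real.exp (-T⁻¹ * P.U (σ x).1) *
          ((Real.sqrt (2 * Real.pi * T))⁻¹ * Real.exp (-(σ x).2 ^ 2 / (2 * T))))) *
        ∏ x ∈ Ico a b, Real.exp (-T⁻¹ * P.V ((σ (x + 1)).1 - (σ x).1))) *
      ((lam⁻¹ * (ψ (σ a).1)⁻¹ *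
          (Real.exp (-T⁻¹ * P.U (σ (a - 1)).1) *
            (Real.exp (-T⁻¹ * P.V ((σ a).1 - (σ (a - 1)).1)) * ψ (σ (a - 1)).1))) *
        ((Real.sqrt (2 * Real.pi * T))⁻¹ * Real.exp (-(σ (a - 1)).2 ^ 2 / (2 * T)))) := by
  -- split off the new site from both products
  have hIcc : Icc (a - 1) b = insert (a - 1) (Icc a b) := by
    have h := insert_Icc_add_one_left_eq_Icc (show a - 1 ≤ b by omega)
    rw [sub_add_cancel] at h
    exact h.symm
  have hIco : Ico (a - 1) b = insert (a - 1) (Ico a b) := by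
    have h := insert_Ico_add_one_left_eq_Ico (show a - 1 < b by omega)
    rw [sub_add_cancel] at h
    exact h.symm
  have hnot1 : a - 1 ∉ Icc a b := by simp
  have hnot2 : a - 1 ∉ Ico a b := by simp
  have hpow : (b - (a - 1)).toNat = (b - a).toNat + 1 := by omega
  rw [hIcc, hIco, prod_insert hnot1, prod_insert hnot2, hpow, pow_succ, sub_add_cancel]
  field_simp

/-- **The one-site window density**: `ρ_{a,a}(σ) = ψ(q_a)² e^{-U(q_a)/T} (2πT)^{-1/2} e^{-p_a²/(2T)}`
(the invariant one-site law of the chain, of total mass `∫ ψ² e^{-U/T} = 1`). [cite: Georgii2011, §3.1] -/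
theorem windowDensity_self (T lam : ℝ) (ψ : ℝ → ℝ) (a : ℤ) (σ : ChainConfig) :
    ψ (σ a).1 * ψ (σ a).1 * lam⁻¹ ^ (a - a).toNat *
        (∏ x ∈ Icc a a, (Real.exp (-T⁻¹ * P.U (σ x).1) *
          ((Real.sqrt (2 * Real.pi * T))⁻¹ * Real.exp (-(σ x).2 ^ 2 / (2 * T))))) *
        ∏ x ∈ Ico a a, Real.exp (-T⁻¹ * P.V ((σ (x + 1)).1 - (σ x).1)) =
      ψ (σ a).1 ^ 2 * (Real.exp (-T⁻¹ * P.U (σ a).1) *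
        ((Real.sqrt (2 * Real.pi * T))⁻¹ * Real.exp (-(σ a).2 ^ 2 / (2 * T)))) := by
  simp [sq]

end OscillatorChain

end Literature.MathematicalPhysics.KineticTheory.HeatConduction
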